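import Summits.AtomisticToContinuum.BoseEinsteinCondensation.Theorems.BECHeatBathGapSquareSummableInfluencePairProductInsertion
import Summits.AtomisticToContinuum.BoseEinsteinCondensation.Theorems.BECHeatBathGapSquareSummableInfluencePairProductNorm
import HarnessLib

/-!
# Route `BECHeatBathGap`, crux `SquareSummableInfluence` (stmt-AtomisticToContinuum-14368), line `registered`:
# the pair-product insertion rung in RELATIVE (normalised) form

Supports (does not close) stmt-AtomisticToContinuum-14368 (lead c3). Combines the two landed rungs
`pairProductInsertion_influence_le` (p156974: dropping the `i`-th pair factor predicts the insertion state
`Ψ_f(Z) = Θ(tail Z) ∏_j f(Z 0 − Z (succ j))` with total squared influence `≤ N ‖1 − f‖₂² ‖Θ‖²_{L²(Λ^N)}`) and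
`pairProductInsertion_norm_ge` (p157097: `‖Ψ_f‖²_{L²(Λ^{N+1})} ≥ (L³ − N ‖1 − f²‖₁) ‖Θ‖²_{L²(Λ^N)}`) into the
scale-free statement A2 is about: the influence RELATIVE to `‖Ψ_f‖²` is at most
`N ‖1 − f‖₂² / (L³ − N ‖1 − f²‖₁) = ρ ‖1 − f‖₂² / (1 − ρ ‖1 − f²‖₁)`, `ρ = N / L³` — for EVERY bath amplitude `Θ`
(in particular the true `N`-body ground state) and every pair factor `0 ≤ f ≤ 1`. So the crux's bound holds for
Bijl–Dingle–Jastrow / Dyson–LSY insertion states exactly when the pair deficit `1 − f` is square-integrable with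
`ρ ‖1 − f‖₂² → 0`: the undressed zero-energy tail `1 − f ∼ a/r` is NOT in `L²(ℝ³)` (`I ∼ ρ a² L → ∞`), the dressed
(healed at `ξ = (8πρa)^{-1/2}`, then Reatto–Chester `r⁻²`) tail gives `I ≈ 10.6 √(ρa³)`. What A2 asks beyond this
rung is that the TRUE `(N+1)`-body ground state be, coordinate by coordinate, this close to an insertion over the
`N`-body ground state.
-/

noncomputable section

open MeasureTheory Filter
open scoped ENNReal NNReal Topology

namespace Summit.AtomisticToContinuum.BoseEinsteinCondensation.Theorems.SquareSummableInfluence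

open Literature.MathematicalPhysics.QuantumManyBody.BoseGas

/-- **Pair-product insertion rung, relative form.** For a measurable pair factor `0 ≤ f ≤ 1`, any measurable
bath amplitude `Θ` on `Λ_L^N` and the insertion state `Ψ_f(Z) = Θ(tail Z) ∏_j f(Z 0 − Z (succ j))`, the predictors
dropping the `i`-th pair factor (measurable, bounded by `1`, blind to `x_i = Z (succ i)`) satisfy
`(∑_i ∫_{Λ^{N+1}} |Ψ_f − g_i Θ(tail)|²) · (L³ − N ‖1 − f²‖₁) ≤ N ‖1 − f‖₂² · ‖Ψ_f‖²_{L²(Λ^{N+1})}`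
(truncated subtraction in `ℝ≥0∞`), i.e. relative influence `≤ ρ‖1 − f‖₂²/(1 − ρ‖1 − f²‖₁)`.
[cite: LiebSeiringerSolovejYngvason2005, §2.1 (2.11)–(2.12)] [cite: Reatto1969, §II] -/
theorem pairProductInsertion_relativeInfluence_le :
    ∀ (N : ℕ) (L : ℝ) (f : Space → ℝ) (Θ : Config N → ℂ), Measurable f → (∀ x, 0 ≤ f x ∧ f x ≤ 1) →
      Measurable Θ →
      ∃ g : Fin N → Config (N + 1) → ℂ,
        (∀ i, Measurable (g i)) ∧ (∀ i Z, ‖g i Z‖ ≤ 1) ∧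
        (∀ i Z x, g i (Function.update Z (Fin.succ i) x) = g i Z) ∧
        (∑ i : Fin N, ∫⁻ Z in boxN (N + 1) L,
            (‖Θ (Matrix.vecTail Z) * (∏ j : Fin N, (f (Z 0 - Z (Fin.succ j)) : ℂ)) -
                g i Z * Θ (Matrix.vecTail Z)‖₊ : ℝ≥0∞) ^ 2) *
            (ENNReal.ofReal L ^ 3 - (N : ℝ≥0∞) * ∫⁻ x, ENNReal.ofReal (1 - f x ^ 2)) ≤
          (N : ℝ≥0∞) * (∫⁻ x, ENNReal.ofReal ((1 - f x) ^ 2)) *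
            ∫⁻ Z in boxN (N + 1) L,
              (‖Θ (Matrix.vecTail Z) * (∏ j : Fin N, (f (Z 0 - Z (Fin.succ j)) : ℂ))‖₊ : ℝ≥0∞) ^ 2 := by
  intro N L f Θ hf hf01 hΘ
  obtain ⟨g, hgm, hgb, hgu, hsum⟩ := pairProductInsertion_influence_le N L f Θ hf hf01 hΘ
  have hnorm := pairProductInsertion_norm_ge N L f Θ hf hf01 hΘ
  refine ⟨g, hgm, hgb, hgu, ?_⟩
  calc (∑ i : Fin N, ∫⁻ Z in boxN (N + 1) L,
          (‖Θ (Matrix.vecTail Z) * (∏ j : Fin N, (f (Z 0 - Z (Fin.succ j)) : ℂ)) -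
              g i Z * Θ (Matrix.vecTail Z)‖₊ : ℝ≥0∞) ^ 2) *
          (ENNReal.ofReal L ^ 3 - (N : ℝ≥0∞) * ∫⁻ x, ENNReal.ofReal (1 - f x ^ 2))
      ≤ ((N : ℝ≥0∞) * (∫⁻ x, ENNReal.ofReal ((1 - f x) ^ 2)) *
            ∫⁻ X in boxN N L, (‖Θ X‖₊ : ℝ≥0∞) ^ 2) *
          (ENNReal.ofReal L ^ 3 - (N : ℝ≥0∞) * ∫⁻ x, ENNReal.ofReal (1 - f x ^ 2)) := by
        gcongr
    _ = (N : ℝ≥0∞) * (∫⁻ x, ENNReal.ofReal ((1 - f x) ^ 2)) *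
          ((ENNReal.ofReal L ^ 3 - (N : ℝ≥0∞) * ∫⁻ x, ENNReal.ofReal (1 - f x ^ 2)) *
            ∫⁻ X in boxN N L, (‖Θ X‖₊ : ℝ≥0∞) ^ 2) := by
        ring
    _ ≤ (N : ℝ≥0∞) * (∫⁻ x, ENNReal.ofReal ((1 - f x) ^ 2)) *
          ∫⁻ Z in boxN (N + 1) L,
            (‖Θ (Matrix.vecTail Z) * (∏ j : Fin N, (f (Z 0 - Z (Fin.succ j)) : ℂ))‖₊ : ℝ≥0∞) ^ 2 := by
        gcongr

end Summit.AtomisticToContinuum.BoseEinsteinCondensation.Theorems.SquareSummableInfluence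

end
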